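import Mathlib
import HarnessLib

/-!
# Gaussian MOMENTS are log-free: `∫e^{−N}(N+1)^k dμ ≤ A_{k,m}·V` from polynomial volume growth `μ{N ≤ t} ≤ V(t+1)^m`, the floor `e^{−a}μ{N ≤ 1} ≤ ∫e^{−aN}`, and the moment RATIO
# (tool for the second-order DIAGONAL analysis of the rate twin «ratepack-v3 / frozen fibres»; route `FlatTubeReduction`, crux K1 `NearFlatRatioLaw` stmt-QuantumFields-24720;
# seat `ym-line-ftr-p1` g12; R2b1 RECORD rung — no summit statement is proved here)

WHY (memo `Cruxes/NearFlatRatioLaw/Lines/ratepack-v3-frozen-g12.md` §5.4–5.5).  `…DiagonalMomentSandwich.fpBOKernel_diag_two_sided_moment` reduces the two-sidedness constant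
`κ_W` of the exact dressing to two MOMENTS of the `u = 1` reference density `ρ₁ ∝ e^{−βQ}·F` (`Q` the exact kinetic quadratic form, `F ≥ 0` the bounded profile / Faddeev–Popov
factors): `∫ρ₁·M ≤ m·∫ρ₁` with `M ≲ orbitDist(u)²·(βQ + 1)^k`.  RED lane A bounds such quantities by SUP × MASS against a Haar FLOOR at scale `β^{-1}`, which forces radii
`β^{-1/2}log β` and log powers.  The abstract lemma below is the log-free replacement: a dyadic layer-cake in the level `N = βQ` — if the `F`-weighted volume of `{N ≤ t}` grows
at most polynomially, `≤ V(t+1)^m`, then `∫e^{−N}(N+1)^k F ≤ 5e·2^k4^m·k!·m!·V`, while `∫e^{−aN}F ≥ e^{−a}·(F-volume of {N ≤ 1})`; so the moment ratio is a CONSTANT times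
`V / vol_F{N ≤ 1}` — and for `N = β·(quadratic form)` both are `≍ β^{-n/2}`, no logarithm anywhere.
* `pow_le_factorial_mul_exp` (`x^m ≤ c^m·m!·e^{x/c}`), `pow_mul_exp_neg_le` (`(N+1)^k e^{−N} ≤ 2^k k! e^{1/2} e^{−N/2}`), `geom_sum_exp_neg_quarter_le` (`Σ_{j<J} e^{−j/4} ≤ 5`),
  `exp_neg_half_le_dyadic` (the pointwise dyadic decomposition `e^{−N/2} ≤ Σ_{j<J} e^{−j/2}𝟙{N ≤ j+1} + e^{−J/2}`);
* ★ `integral_exp_neg_half_le_of_volume_growth`, ★★ `integral_exp_neg_mul_pow_le_of_volume_growth` (the layer-cake bound), `integral_exp_neg_ge_floor` (the floor);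
* ★★ `moment_ratio_le_of_volume_growth` — for `0 ≤ ρ ≤ C₁e^{−N}`, `c₁e^{−2N} ≤ ρ`, `0 ≤ M ≤ D(N+1)^k`: `∫ρM ≤ (5e³2^k4^m k! m!·C₁DV/(c₁v))·∫ρ` whenever `v ≤ μ{N ≤ 1}`, `0 < v`;
* `setIntegral_exp_neg_le_of_volume_growth` (§4, appended) — the tail above a level: `∫_{T<N} e^{−N} ≤ e^{−T/2}·5e^{1/2}4^m m!·V`;
* ★★ `moment_ratio_le_of_volume_growth_floorSet` (§5, appended) — the ratio with the lower bound only ON A FLOOR SET `A` (`ρ ≥ c₁` on `A`, `μ(A) ≥ v`): constant `5e·…·C₁DV/(c₁v)`.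
HONEST FRAMING: elementary measure theory (Mathlib only); femto rung R2b1 (RECORD label); not infinite volume, not a gap, not Clay.  No defs, no named facts, no `sorry`.
-/

set_option autoImplicit false

noncomputable section

open MeasureTheory Filter Topology Real
open scoped BigOperators

namespace Summit.QuantumFields.YangMills.Theorems.FemtoTransferGap.RateTube

/-! ## §1 Elementary real inequalities -/

/-- `x^m ≤ c^m·m!·e^{x/c}` for `x ≥ 0`, `c > 0` (from `y^m/m! ≤ e^y`). [folklore] -/
theorem pow_le_factorial_mul_exp {x c : ℝ} (hx : 0 ≤ x) (hc : 0 < c) (m : ℕ) : x ^ m ≤ c ^ m * m.factorial * Real.exp (x / c) := by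
  have h := Real.pow_div_factorial_le_exp (x / c) (by positivity) m
  have hm : (0 : ℝ) < m.factorial := by exact_mod_cast Nat.factorial_pos m
  rw [div_pow, div_div, div_le_iff₀ (by positivity)] at h
  linarith

/-- `(N+1)^k·e^{−N} ≤ 2^k·k!·e^{1/2}·e^{−N/2}` for `N ≥ 0`. [folklore] -/
theorem pow_mul_exp_neg_le {N : ℝ} (hN : 0 ≤ N) (k : ℕ) : (N + 1) ^ k * Real.exp (-N) ≤ 2 ^ k * k.factorial * Real.exp (1 / 2) * Real.exp (-(N / 2)) := by
  have h := pow_le_factorial_mul_exp (x := N + 1) (by linarith) two_pos k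
  have e : Real.exp ((N + 1) / 2) * Real.exp (-N) = Real.exp (1 / 2) * Real.exp (-(N / 2)) := by
    rw [← Real.exp_add, ← Real.exp_add]; ring_nf
  calc (N + 1) ^ k * Real.exp (-N) ≤ 2 ^ k * k.factorial * Real.exp ((N + 1) / 2) * Real.exp (-N) := mul_le_mul_of_nonneg_right h (Real.exp_pos _).le
    _ = 2 ^ k * k.factorial * (Real.exp ((N + 1) / 2) * Real.exp (-N)) := by ring
    _ = 2 ^ k * k.factorial * Real.exp (1 / 2) * Real.exp (-(N / 2)) := by rw [e]; ring

/-- `Σ_{j<J} e^{−j/4} ≤ 5`. [folklore] -/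
theorem geom_sum_exp_neg_quarter_le (J : ℕ) : ∑ j ∈ Finset.range J, Real.exp (-((j : ℝ) / 4)) ≤ 5 := by
  have hr : Real.exp (-(1 / 4 : ℝ)) ≤ 4 / 5 := by
    have h1 : (1 : ℝ) + 1 / 4 ≤ Real.exp (1 / 4) := by linarith [Real.add_one_le_exp (1 / 4 : ℝ)]
    rw [Real.exp_neg, inv_le_comm₀ (Real.exp_pos _) (by norm_num)]
    linarith
  have hterm : ∀ j : ℕ, Real.exp (-((j : ℝ) / 4)) ≤ (4 / 5 : ℝ) ^ j := fun j => by
    have e : Real.exp (-((j : ℝ) / 4)) = Real.exp (-(1 / 4 : ℝ)) ^ j := by rw [← Real.exp_nat_mul]; ring_nf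
    rw [e]; exact pow_le_pow_left₀ (Real.exp_pos _).le hr j
  calc ∑ j ∈ Finset.range J, Real.exp (-((j : ℝ) / 4)) ≤ ∑ j ∈ Finset.range J, (4 / 5 : ℝ) ^ j := Finset.sum_le_sum fun j _ => hterm j
    _ = ((4 / 5 : ℝ) ^ J - 1) / (4 / 5 - 1) := geom_sum_eq (by norm_num) J
    _ ≤ 5 := by
        have h0 : (0 : ℝ) ≤ (4 / 5 : ℝ) ^ J := by positivity
        rw [div_le_iff_of_neg (by norm_num)]; linarith

/-- The term bound of the dyadic sum: `e^{−j/2}(j+2)^m ≤ 4^m·m!·e^{1/2}·e^{−j/4}`. [folklore] -/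
theorem exp_neg_half_mul_pow_le (j m : ℕ) : Real.exp (-((j : ℝ) / 2)) * ((j : ℝ) + 2) ^ m ≤ 4 ^ m * m.factorial * Real.exp (1 / 2) * Real.exp (-((j : ℝ) / 4)) := by
  have h := pow_le_factorial_mul_exp (x := (j : ℝ) + 2) (by positivity) (by norm_num : (0 : ℝ) < 4) m
  have e : Real.exp (-((j : ℝ) / 2)) * Real.exp (((j : ℝ) + 2) / 4) = Real.exp (1 / 2) * Real.exp (-((j : ℝ) / 4)) := by
    rw [← Real.exp_add, ← Real.exp_add]; ring_nf
  calc Real.exp (-((j : ℝ) / 2)) * ((j : ℝ) + 2) ^ m ≤ Real.exp (-((j : ℝ) / 2)) * (4 ^ m * m.factorial * Real.exp (((j : ℝ) + 2) / 4)) :=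
        mul_le_mul_of_nonneg_left h (Real.exp_pos _).le
    _ = 4 ^ m * m.factorial * (Real.exp (-((j : ℝ) / 2)) * Real.exp (((j : ℝ) + 2) / 4)) := by ring
    _ = 4 ^ m * m.factorial * Real.exp (1 / 2) * Real.exp (-((j : ℝ) / 4)) := by rw [e]; ring

/-- ★ The pointwise DYADIC decomposition: for `N ≥ 0` and every `J`, `e^{−N/2} ≤ Σ_{j<J} e^{−j/2}·𝟙{N ≤ j+1} + e^{−J/2}`. [folklore] -/
theorem exp_neg_half_le_dyadic {X : Type*} (N : X → ℝ) {x : X} (hN : 0 ≤ N x) (J : ℕ) :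
    Real.exp (-(N x / 2)) ≤ ∑ j ∈ Finset.range J, Real.exp (-((j : ℝ) / 2)) * Set.indicator {y | N y ≤ (j : ℝ) + 1} (fun _ => (1 : ℝ)) x + Real.exp (-((J : ℝ) / 2)) := by
  have hnn : ∀ j ∈ Finset.range J, 0 ≤ Real.exp (-((j : ℝ) / 2)) * Set.indicator {y | N y ≤ (j : ℝ) + 1} (fun _ => (1 : ℝ)) x := fun j _ =>
    mul_nonneg (Real.exp_pos _).le (Set.indicator_nonneg (fun _ _ => zero_le_one) _)
  have hsum0 : 0 ≤ ∑ j ∈ Finset.range J, Real.exp (-((j : ℝ) / 2)) * Set.indicator {y | N y ≤ (j : ℝ) + 1} (fun _ => (1 : ℝ)) x := Finset.sum_nonneg hnn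
  by_cases hJ : (J : ℝ) ≤ N x
  · have h1 : Real.exp (-(N x / 2)) ≤ Real.exp (-((J : ℝ) / 2)) := Real.exp_le_exp.mpr (by linarith)
    linarith
  · push Not at hJ
    set j₀ : ℕ := ⌊N x⌋₊ with hj₀
    have hfl : (j₀ : ℝ) ≤ N x := Nat.floor_le hN
    have hlt : N x < (j₀ : ℝ) + 1 := Nat.lt_floor_add_one (N x)
    have hj₀J : j₀ ∈ Finset.range J := by
      rw [Finset.mem_range]; exact_mod_cast (show (j₀ : ℝ) < J from lt_of_le_of_lt hfl hJ)
    have hind : Set.indicator {y | N y ≤ (j₀ : ℝ) + 1} (fun _ => (1 : ℝ)) x = 1 := Set.indicator_of_mem (show x ∈ {y | N y ≤ (j₀ : ℝ) + 1} from hlt.le) _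
    have hone : Real.exp (-(N x / 2)) ≤ Real.exp (-((j₀ : ℝ) / 2)) * Set.indicator {y | N y ≤ (j₀ : ℝ) + 1} (fun _ => (1 : ℝ)) x := by
      rw [hind, mul_one]; exact Real.exp_le_exp.mpr (by linarith)
    have hsingle := Finset.single_le_sum hnn hj₀J
    linarith [hone, hsingle, (Real.exp_pos (-((J : ℝ) / 2))).le]

/-! ## §2 ★★ The layer-cake bound and the floor -/

variable {X : Type*} [MeasurableSpace X]

/-- ★ **LAYER CAKE, exponent `1/2`.**  On a finite measure space, for measurable `N ≥ 0` with `μ{N ≤ t} ≤ V(t+1)^m` (`t ≥ 0`): `∫e^{−N/2} dμ ≤ 5e^{1/2}·4^m·m!·V`. [folklore] -/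
theorem integral_exp_neg_half_le_of_volume_growth (μ : Measure X) [IsFiniteMeasure μ] {N : X → ℝ} (hNm : Measurable N) (hN0 : ∀ x, 0 ≤ N x) {V : ℝ} {m : ℕ}
    (hV : ∀ t : ℝ, 0 ≤ t → μ.real {x | N x ≤ t} ≤ V * (t + 1) ^ m) :
    ∫ x, Real.exp (-(N x / 2)) ∂μ ≤ 5 * Real.exp (1 / 2) * 4 ^ m * m.factorial * V := by
  have hmeas : ∀ j : ℕ, MeasurableSet {x | N x ≤ (j : ℝ) + 1} := fun j => hNm measurableSet_Iic
  have hindint : ∀ j : ℕ, Integrable (fun x => Real.exp (-((j : ℝ) / 2)) * Set.indicator {y | N y ≤ (j : ℝ) + 1} (fun _ => (1 : ℝ)) x) μ := fun j =>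
    ((integrable_const (1 : ℝ)).indicator (hmeas j)).const_mul _
  have hexpint : Integrable (fun x => Real.exp (-(N x / 2))) μ :=
    Integrable.mono' (integrable_const (1 : ℝ)) ((Real.measurable_exp.comp (hNm.div_const 2).neg).aestronglyMeasurable)
      (ae_of_all _ fun x => by
        rw [Real.norm_eq_abs, abs_of_pos (Real.exp_pos _)]
        exact Real.exp_le_one_iff.mpr (by linarith [hN0 x]))
  -- the bound for every `J`
  have hJ : ∀ J : ℕ, ∫ x, Real.exp (-(N x / 2)) ∂μ ≤ 5 * Real.exp (1 / 2) * 4 ^ m * m.factorial * V + Real.exp (-((J : ℝ) / 2)) * μ.real Set.univ := fun J => by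
    have hsumint : Integrable (fun x => ∑ j ∈ Finset.range J, Real.exp (-((j : ℝ) / 2)) * Set.indicator {y | N y ≤ (j : ℝ) + 1} (fun _ => (1 : ℝ)) x) μ :=
      integrable_finsetSum _ fun j _ => hindint j
    have h1 : ∫ x, Real.exp (-(N x / 2)) ∂μ ≤
        ∫ x, (∑ j ∈ Finset.range J, Real.exp (-((j : ℝ) / 2)) * Set.indicator {y | N y ≤ (j : ℝ) + 1} (fun _ => (1 : ℝ)) x + Real.exp (-((J : ℝ) / 2))) ∂μ :=
      integral_mono hexpint (hsumint.add (integrable_const _)) fun x => exp_neg_half_le_dyadic N (hN0 x) J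
    have h2 : ∫ x, (∑ j ∈ Finset.range J, Real.exp (-((j : ℝ) / 2)) * Set.indicator {y | N y ≤ (j : ℝ) + 1} (fun _ => (1 : ℝ)) x + Real.exp (-((J : ℝ) / 2))) ∂μ =
        ∑ j ∈ Finset.range J, Real.exp (-((j : ℝ) / 2)) * μ.real {y | N y ≤ (j : ℝ) + 1} + Real.exp (-((J : ℝ) / 2)) * μ.real Set.univ := by
      rw [integral_add hsumint (integrable_const _), integral_finsetSum _ fun j _ => hindint j, integral_const, smul_eq_mul, mul_comm (μ.real Set.univ)]
      congr 1
      refine Finset.sum_congr rfl fun j _ => ?_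
      rw [integral_const_mul, integral_indicator_const _ (hmeas j), smul_eq_mul, mul_one]
    have h3 : ∑ j ∈ Finset.range J, Real.exp (-((j : ℝ) / 2)) * μ.real {y | N y ≤ (j : ℝ) + 1} ≤ 5 * Real.exp (1 / 2) * 4 ^ m * m.factorial * V := by
      have hV0 : 0 ≤ V := by
        have h := hV 0 le_rfl
        have h' : 0 ≤ μ.real {x | N x ≤ 0} := measureReal_nonneg
        simp only [zero_add, one_pow, mul_one] at h
        linarith
      calc ∑ j ∈ Finset.range J, Real.exp (-((j : ℝ) / 2)) * μ.real {y | N y ≤ (j : ℝ) + 1}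
          ≤ ∑ j ∈ Finset.range J, 4 ^ m * m.factorial * Real.exp (1 / 2) * V * Real.exp (-((j : ℝ) / 4)) := by
            refine Finset.sum_le_sum fun j _ => ?_
            have hv := hV ((j : ℝ) + 1) (by positivity)
            have e : ((j : ℝ) + 1 + 1) = (j : ℝ) + 2 := by ring
            rw [e] at hv
            calc Real.exp (-((j : ℝ) / 2)) * μ.real {y | N y ≤ (j : ℝ) + 1} ≤ Real.exp (-((j : ℝ) / 2)) * (V * ((j : ℝ) + 2) ^ m) :=
                  mul_le_mul_of_nonneg_left hv (Real.exp_pos _).le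
              _ = V * (Real.exp (-((j : ℝ) / 2)) * ((j : ℝ) + 2) ^ m) := by ring
              _ ≤ V * (4 ^ m * m.factorial * Real.exp (1 / 2) * Real.exp (-((j : ℝ) / 4))) := mul_le_mul_of_nonneg_left (exp_neg_half_mul_pow_le j m) hV0
              _ = 4 ^ m * m.factorial * Real.exp (1 / 2) * V * Real.exp (-((j : ℝ) / 4)) := by ring
        _ = 4 ^ m * m.factorial * Real.exp (1 / 2) * V * ∑ j ∈ Finset.range J, Real.exp (-((j : ℝ) / 4)) := by rw [Finset.mul_sum]
        _ ≤ 4 ^ m * m.factorial * Real.exp (1 / 2) * V * 5 := mul_le_mul_of_nonneg_left (geom_sum_exp_neg_quarter_le J) (by positivity)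
        _ = 5 * Real.exp (1 / 2) * 4 ^ m * m.factorial * V := by ring
    linarith [h1, h2, h3]
  -- let `J → ∞`
  have ht : Tendsto (fun J : ℕ => 5 * Real.exp (1 / 2) * 4 ^ m * m.factorial * V + Real.exp (-((J : ℝ) / 2)) * μ.real Set.univ) atTop
      (𝓝 (5 * Real.exp (1 / 2) * 4 ^ m * m.factorial * V + 0 * μ.real Set.univ)) := by
    have h0 : Tendsto (fun J : ℕ => Real.exp (-((J : ℝ) / 2))) atTop (𝓝 0) :=
      Real.tendsto_exp_neg_atTop_nhds_zero.comp ((tendsto_natCast_atTop_atTop (R := ℝ)).atTop_div_const two_pos)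
    exact tendsto_const_nhds.add (h0.mul_const _)
  rw [zero_mul, add_zero] at ht
  exact ge_of_tendsto' ht hJ

/-- ★★ **LAYER CAKE with a polynomial weight.**  Same hypotheses: `∫e^{−N}(N+1)^k dμ ≤ 5e·2^k·4^m·k!·m!·V` (`e = e^{1/2}·e^{1/2}`). [folklore] -/
theorem integral_exp_neg_mul_pow_le_of_volume_growth (μ : Measure X) [IsFiniteMeasure μ] {N : X → ℝ} (hNm : Measurable N) (hN0 : ∀ x, 0 ≤ N x) {V : ℝ} {m : ℕ}
    (hV : ∀ t : ℝ, 0 ≤ t → μ.real {x | N x ≤ t} ≤ V * (t + 1) ^ m) (k : ℕ) :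
    ∫ x, Real.exp (-N x) * (N x + 1) ^ k ∂μ ≤ 5 * Real.exp 1 * 2 ^ k * 4 ^ m * k.factorial * m.factorial * V := by
  have hexpint : Integrable (fun x => Real.exp (-(N x / 2))) μ :=
    Integrable.mono' (integrable_const (1 : ℝ)) ((Real.measurable_exp.comp (hNm.div_const 2).neg).aestronglyMeasurable)
      (ae_of_all _ fun x => by
        rw [Real.norm_eq_abs, abs_of_pos (Real.exp_pos _)]
        exact Real.exp_le_one_iff.mpr (by linarith [hN0 x]))
  have hpt : ∀ x, Real.exp (-N x) * (N x + 1) ^ k ≤ 2 ^ k * k.factorial * Real.exp (1 / 2) * Real.exp (-(N x / 2)) := fun x => by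
    rw [mul_comm]; exact pow_mul_exp_neg_le (hN0 x) k
  have hint : Integrable (fun x => Real.exp (-N x) * (N x + 1) ^ k) μ :=
    Integrable.mono' (hexpint.const_mul (2 ^ k * k.factorial * Real.exp (1 / 2)))
      (((Real.measurable_exp.comp hNm.neg).mul ((hNm.add_const 1).pow_const k)).aestronglyMeasurable)
      (ae_of_all _ fun x => by
        rw [Real.norm_eq_abs, abs_of_nonneg (mul_nonneg (Real.exp_pos _).le (pow_nonneg (by linarith [hN0 x]) _))]
        exact hpt x)
  have h1 := integral_mono hint (hexpint.const_mul (2 ^ k * k.factorial * Real.exp (1 / 2))) hpt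
  have h2 := integral_exp_neg_half_le_of_volume_growth μ hNm hN0 hV
  have e1 : Real.exp 1 = Real.exp (1 / 2) * Real.exp (1 / 2) := by rw [← Real.exp_add]; norm_num
  calc ∫ x, Real.exp (-N x) * (N x + 1) ^ k ∂μ ≤ ∫ x, 2 ^ k * k.factorial * Real.exp (1 / 2) * Real.exp (-(N x / 2)) ∂μ := h1
    _ = 2 ^ k * k.factorial * Real.exp (1 / 2) * ∫ x, Real.exp (-(N x / 2)) ∂μ := integral_const_mul _ _
    _ ≤ 2 ^ k * k.factorial * Real.exp (1 / 2) * (5 * Real.exp (1 / 2) * 4 ^ m * m.factorial * V) := mul_le_mul_of_nonneg_left h2 (by positivity)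
    _ = 5 * Real.exp 1 * 2 ^ k * 4 ^ m * k.factorial * m.factorial * V := by rw [e1]; ring

/-- **THE FLOOR**: `e^{−a}·μ{N ≤ 1} ≤ ∫e^{−aN} dμ` for `a ≥ 0`, `N ≥ 0` measurable, `μ` finite. [folklore] -/
theorem integral_exp_neg_ge_floor (μ : Measure X) [IsFiniteMeasure μ] {N : X → ℝ} (hNm : Measurable N) (hN0 : ∀ x, 0 ≤ N x) {a : ℝ} (ha : 0 ≤ a) :
    Real.exp (-a) * μ.real {x | N x ≤ 1} ≤ ∫ x, Real.exp (-(a * N x)) ∂μ := by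
  have hmeas : MeasurableSet {x | N x ≤ 1} := hNm measurableSet_Iic
  have hexpint : Integrable (fun x => Real.exp (-(a * N x))) μ :=
    Integrable.mono' (integrable_const (1 : ℝ)) ((Real.measurable_exp.comp (hNm.const_mul a).neg).aestronglyMeasurable)
      (ae_of_all _ fun x => by
        rw [Real.norm_eq_abs, abs_of_pos (Real.exp_pos _)]
        exact Real.exp_le_one_iff.mpr (by nlinarith [hN0 x]))
  have hpt : ∀ x, Set.indicator {x | N x ≤ 1} (fun _ => Real.exp (-a)) x ≤ Real.exp (-(a * N x)) := fun x => by
    by_cases hx : x ∈ {x | N x ≤ 1}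
    · rw [Set.indicator_of_mem hx]
      have hx' : N x ≤ 1 := hx
      exact Real.exp_le_exp.mpr (by nlinarith)
    · rw [Set.indicator_of_notMem hx]; exact (Real.exp_pos _).le
  have h := integral_mono ((integrable_const (Real.exp (-a))).indicator hmeas) hexpint hpt
  rw [integral_indicator_const _ hmeas, smul_eq_mul, mul_comm] at h
  exact h

/-! ## §3 ★★ The moment ratio -/

/-- Integrability of the layer-cake integrand `e^{−N}(N+1)^k` on a finite measure space (`N ≥ 0` measurable). [folklore] -/
theorem integrable_exp_neg_mul_pow (μ : Measure X) [IsFiniteMeasure μ] {N : X → ℝ} (hNm : Measurable N) (hN0 : ∀ x, 0 ≤ N x) (k : ℕ) :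
    Integrable (fun x => Real.exp (-N x) * (N x + 1) ^ k) μ := by
  have hpt : ∀ x, Real.exp (-N x) * (N x + 1) ^ k ≤ 2 ^ k * k.factorial * Real.exp (1 / 2) := fun x => by
    have h := pow_mul_exp_neg_le (hN0 x) k
    have h1 : Real.exp (-(N x / 2)) ≤ 1 := Real.exp_le_one_iff.mpr (by linarith [hN0 x])
    rw [mul_comm]
    calc (N x + 1) ^ k * Real.exp (-N x) ≤ 2 ^ k * k.factorial * Real.exp (1 / 2) * Real.exp (-(N x / 2)) := h
      _ ≤ 2 ^ k * k.factorial * Real.exp (1 / 2) * 1 := mul_le_mul_of_nonneg_left h1 (by positivity)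
      _ = 2 ^ k * k.factorial * Real.exp (1 / 2) := mul_one _
  exact Integrable.mono' (integrable_const (2 ^ k * k.factorial * Real.exp (1 / 2)))
    (((Real.measurable_exp.comp hNm.neg).mul ((hNm.add_const 1).pow_const k)).aestronglyMeasurable)
    (ae_of_all _ fun x => by
      rw [Real.norm_eq_abs, abs_of_nonneg (mul_nonneg (Real.exp_pos _).le (pow_nonneg (by linarith [hN0 x]) _))]
      exact hpt x)

/-- ★★ **MOMENT RATIO.**  `μ` finite, `N ≥ 0` measurable with volume growth `μ{N ≤ t} ≤ V(t+1)^m` and floor `0 < v ≤ μ{N ≤ 1}`; a measurable density `ρ` with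
`0 ≤ ρ ≤ C₁e^{−N}` and `c₁e^{−2N} ≤ ρ` (`c₁ > 0`); a measurable weight `0 ≤ M ≤ D(N+1)^k`.  Then `∫ρM dμ ≤ (5e³·2^k·4^m·k!·m!·C₁·D·V/(c₁v))·∫ρ dμ` — a CONSTANT
times `V/v` (for `N = β·(quadratic form)` both are `≍ β^{-n/2}`: no logarithm). [folklore] -/
theorem moment_ratio_le_of_volume_growth (μ : Measure X) [IsFiniteMeasure μ] {N : X → ℝ} (hNm : Measurable N) (hN0 : ∀ x, 0 ≤ N x) {V : ℝ} {m : ℕ}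
    (hV : ∀ t : ℝ, 0 ≤ t → μ.real {x | N x ≤ t} ≤ V * (t + 1) ^ m) {v : ℝ} (hv0 : 0 < v) (hv : v ≤ μ.real {x | N x ≤ 1})
    {ρ M : X → ℝ} (hρm : Measurable ρ) (hMm : Measurable M) (hρ0 : ∀ x, 0 ≤ ρ x) {C₁ c₁ D : ℝ} (hC₁ : 0 ≤ C₁) (hc₁ : 0 < c₁) (hD : 0 ≤ D)
    (hρup : ∀ x, ρ x ≤ C₁ * Real.exp (-N x)) (hρlow : ∀ x, c₁ * Real.exp (-(2 * N x)) ≤ ρ x) (hM0 : ∀ x, 0 ≤ M x) {k : ℕ} (hM : ∀ x, M x ≤ D * (N x + 1) ^ k) :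
    ∫ x, ρ x * M x ∂μ ≤ 5 * Real.exp 3 * 2 ^ k * 4 ^ m * k.factorial * m.factorial * C₁ * D * V / (c₁ * v) * ∫ x, ρ x ∂μ := by
  have hV0 : 0 ≤ V := by
    have h := hV 0 le_rfl
    have h' : 0 ≤ μ.real {x | N x ≤ 0} := measureReal_nonneg
    simp only [zero_add, one_pow, mul_one] at h
    linarith
  set A : ℝ := 5 * Real.exp 1 * 2 ^ k * 4 ^ m * k.factorial * m.factorial * V with hA
  have hA0 : 0 ≤ A := by rw [hA]; positivity
  -- upper bound of the numerator
  have hbase := integrable_exp_neg_mul_pow μ hNm hN0 k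
  have hpt : ∀ x, ρ x * M x ≤ C₁ * D * (Real.exp (-N x) * (N x + 1) ^ k) := fun x => by
    have h0 : 0 ≤ N x + 1 := by linarith [hN0 x]
    calc ρ x * M x ≤ (C₁ * Real.exp (-N x)) * (D * (N x + 1) ^ k) := mul_le_mul (hρup x) (hM x) (hM0 x) (by positivity)
      _ = C₁ * D * (Real.exp (-N x) * (N x + 1) ^ k) := by ring
  have hint : Integrable (fun x => ρ x * M x) μ :=
    Integrable.mono' (hbase.const_mul (C₁ * D)) ((hρm.mul hMm).aestronglyMeasurable)
      (ae_of_all _ fun x => by rw [Real.norm_eq_abs, abs_of_nonneg (mul_nonneg (hρ0 x) (hM0 x))]; exact hpt x)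
  have hnum : ∫ x, ρ x * M x ∂μ ≤ C₁ * D * A := by
    calc ∫ x, ρ x * M x ∂μ ≤ ∫ x, C₁ * D * (Real.exp (-N x) * (N x + 1) ^ k) ∂μ := integral_mono hint (hbase.const_mul _) hpt
      _ = C₁ * D * ∫ x, Real.exp (-N x) * (N x + 1) ^ k ∂μ := integral_const_mul _ _
      _ ≤ C₁ * D * A := mul_le_mul_of_nonneg_left (integral_exp_neg_mul_pow_le_of_volume_growth μ hNm hN0 hV k) (by positivity)
  -- lower bound of the denominator
  have hρint : Integrable ρ μ :=
    Integrable.mono' (integrable_const C₁) hρm.aestronglyMeasurable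
      (ae_of_all _ fun x => by
        rw [Real.norm_eq_abs, abs_of_nonneg (hρ0 x)]
        calc ρ x ≤ C₁ * Real.exp (-N x) := hρup x
          _ ≤ C₁ * 1 := mul_le_mul_of_nonneg_left (Real.exp_le_one_iff.mpr (by linarith [hN0 x])) hC₁
          _ = C₁ := mul_one _)
  have hexp2int : Integrable (fun x => Real.exp (-(2 * N x))) μ :=
    Integrable.mono' (integrable_const (1 : ℝ)) ((Real.measurable_exp.comp (hNm.const_mul 2).neg).aestronglyMeasurable)
      (ae_of_all _ fun x => by
        rw [Real.norm_eq_abs, abs_of_pos (Real.exp_pos _)]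
        exact Real.exp_le_one_iff.mpr (by nlinarith [hN0 x]))
  have hden : c₁ * Real.exp (-2) * v ≤ ∫ x, ρ x ∂μ := by
    have h1 := integral_exp_neg_ge_floor μ hNm hN0 (a := 2) (by norm_num)
    have h2 : ∫ x, c₁ * Real.exp (-(2 * N x)) ∂μ ≤ ∫ x, ρ x ∂μ := integral_mono (hexp2int.const_mul c₁) hρint hρlow
    rw [integral_const_mul] at h2
    have h3 : c₁ * Real.exp (-2) * v ≤ c₁ * (Real.exp (-2) * μ.real {x | N x ≤ 1}) := by
      rw [mul_assoc]; exact mul_le_mul_of_nonneg_left (mul_le_mul_of_nonneg_left hv (Real.exp_pos _).le) hc₁.le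
    nlinarith [h1, h2, h3, hc₁]
  have hden0 : 0 < c₁ * Real.exp (-2) * v := by positivity
  -- combine
  have e : 5 * Real.exp 3 * 2 ^ k * 4 ^ m * k.factorial * m.factorial * C₁ * D * V / (c₁ * v) = C₁ * D * A / (c₁ * Real.exp (-2) * v) := by
    have e3 : Real.exp 3 = Real.exp 1 / Real.exp (-2) := by rw [← Real.exp_sub]; norm_num
    rw [hA, e3]
    field_simp
  rw [e]
  calc ∫ x, ρ x * M x ∂μ ≤ C₁ * D * A := hnum
    _ = C₁ * D * A / (c₁ * Real.exp (-2) * v) * (c₁ * Real.exp (-2) * v) := by field_simp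
    _ ≤ C₁ * D * A / (c₁ * Real.exp (-2) * v) * ∫ x, ρ x ∂μ := mul_le_mul_of_nonneg_left hden (by positivity)

/-! ## §4 The tail above a level (appended 2026-08-29) -/

/-- **TAIL ABOVE A LEVEL.**  Same hypotheses as the layer cake: for every threshold `T`, `∫_{T < N} e^{−N} dμ ≤ e^{−T/2}·5e^{1/2}·4^m·m!·V` (`e^{−N} ≤ e^{−T/2}e^{−N/2}` there) — with a
POWER threshold `T = β^{κ}` the Gaussian tail is super-polynomially small relative to the floor, no `log²β` budget. [folklore] -/
theorem setIntegral_exp_neg_le_of_volume_growth (μ : Measure X) [IsFiniteMeasure μ] {N : X → ℝ} (hNm : Measurable N) (hN0 : ∀ x, 0 ≤ N x) {V : ℝ} {m : ℕ}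
    (hV : ∀ t : ℝ, 0 ≤ t → μ.real {x | N x ≤ t} ≤ V * (t + 1) ^ m) (T : ℝ) :
    ∫ x in {x | T < N x}, Real.exp (-N x) ∂μ ≤ Real.exp (-(T / 2)) * (5 * Real.exp (1 / 2) * 4 ^ m * m.factorial * V) := by
  have hmeas : MeasurableSet {x | T < N x} := hNm measurableSet_Ioi
  have hexpint : Integrable (fun x => Real.exp (-(N x / 2))) μ :=
    Integrable.mono' (integrable_const (1 : ℝ)) ((Real.measurable_exp.comp (hNm.div_const 2).neg).aestronglyMeasurable)
      (ae_of_all _ fun x => by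
        rw [Real.norm_eq_abs, abs_of_pos (Real.exp_pos _)]
        exact Real.exp_le_one_iff.mpr (by linarith [hN0 x]))
  have hexpint1 : Integrable (fun x => Real.exp (-N x)) μ :=
    Integrable.mono' (integrable_const (1 : ℝ)) ((Real.measurable_exp.comp hNm.neg).aestronglyMeasurable)
      (ae_of_all _ fun x => by
        rw [Real.norm_eq_abs, abs_of_pos (Real.exp_pos _)]
        exact Real.exp_le_one_iff.mpr (by linarith [hN0 x]))
  have hpt : ∀ x ∈ {x | T < N x}, Real.exp (-N x) ≤ Real.exp (-(T / 2)) * Real.exp (-(N x / 2)) := fun x hx => by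
    have hx' : T < N x := hx
    rw [← Real.exp_add]
    exact Real.exp_le_exp.mpr (by linarith)
  have h0 : 0 ≤ ∫ x in {x | T < N x}ᶜ, Real.exp (-(N x / 2)) ∂μ := setIntegral_nonneg hmeas.compl fun x _ => (Real.exp_pos _).le
  have hsplit := integral_add_compl hmeas hexpint
  calc ∫ x in {x | T < N x}, Real.exp (-N x) ∂μ ≤ ∫ x in {x | T < N x}, Real.exp (-(T / 2)) * Real.exp (-(N x / 2)) ∂μ :=
        setIntegral_mono_on hexpint1.integrableOn (hexpint.const_mul _).integrableOn hmeas hpt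
    _ = Real.exp (-(T / 2)) * ∫ x in {x | T < N x}, Real.exp (-(N x / 2)) ∂μ := integral_const_mul _ _
    _ ≤ Real.exp (-(T / 2)) * ∫ x, Real.exp (-(N x / 2)) ∂μ := mul_le_mul_of_nonneg_left (by linarith) (Real.exp_pos _).le
    _ ≤ Real.exp (-(T / 2)) * (5 * Real.exp (1 / 2) * 4 ^ m * m.factorial * V) :=
        mul_le_mul_of_nonneg_left (integral_exp_neg_half_le_of_volume_growth μ hNm hN0 hV) (Real.exp_pos _).le

/-! ## §5 The moment ratio with a floor SET (appended 2026-08-29) -/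

/-- ★★ **MOMENT RATIO, floor-set form.**  `μ` finite, `N ≥ 0` measurable with volume growth `μ{N ≤ t} ≤ V(t+1)^m`; a measurable density `0 ≤ ρ ≤ C₁e^{−N}` which is `≥ c₁ > 0`
on a set `A` of mass `μ(A) ≥ v > 0` (no global lower Gaussian bound needed — in the application `A` is the core box where all fluctuations are `≤ β^{-1/2}`); a measurable
weight `0 ≤ M ≤ D(N+1)^k`.  Then `∫ρM dμ ≤ (5e·2^k·4^m·k!·m!·C₁·D·V/(c₁v))·∫ρ dμ`. [folklore] -/
theorem moment_ratio_le_of_volume_growth_floorSet (μ : Measure X) [IsFiniteMeasure μ] {N : X → ℝ} (hNm : Measurable N) (hN0 : ∀ x, 0 ≤ N x) {V : ℝ} {m : ℕ}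
    (hV : ∀ t : ℝ, 0 ≤ t → μ.real {x | N x ≤ t} ≤ V * (t + 1) ^ m) {A : Set X} {v : ℝ} (hv0 : 0 < v) (hv : v ≤ μ.real A)
    {ρ M : X → ℝ} (hρm : Measurable ρ) (hMm : Measurable M) (hρ0 : ∀ x, 0 ≤ ρ x) {C₁ c₁ D : ℝ} (hC₁ : 0 ≤ C₁) (hc₁ : 0 < c₁) (hD : 0 ≤ D)
    (hρup : ∀ x, ρ x ≤ C₁ * Real.exp (-N x)) (hρA : ∀ x ∈ A, c₁ ≤ ρ x) (hM0 : ∀ x, 0 ≤ M x) {k : ℕ} (hM : ∀ x, M x ≤ D * (N x + 1) ^ k) :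
    ∫ x, ρ x * M x ∂μ ≤ 5 * Real.exp 1 * 2 ^ k * 4 ^ m * k.factorial * m.factorial * C₁ * D * V / (c₁ * v) * ∫ x, ρ x ∂μ := by
  have hV0 : 0 ≤ V := by
    have h := hV 0 le_rfl
    have h' : 0 ≤ μ.real {x | N x ≤ 0} := measureReal_nonneg
    simp only [zero_add, one_pow, mul_one] at h
    linarith
  set B : ℝ := 5 * Real.exp 1 * 2 ^ k * 4 ^ m * k.factorial * m.factorial * V with hB
  have hB0 : 0 ≤ B := by rw [hB]; positivity
  -- numerator
  have hbase := integrable_exp_neg_mul_pow μ hNm hN0 k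
  have hpt : ∀ x, ρ x * M x ≤ C₁ * D * (Real.exp (-N x) * (N x + 1) ^ k) := fun x => by
    have h0 : 0 ≤ N x + 1 := by linarith [hN0 x]
    calc ρ x * M x ≤ (C₁ * Real.exp (-N x)) * (D * (N x + 1) ^ k) := mul_le_mul (hρup x) (hM x) (hM0 x) (by positivity)
      _ = C₁ * D * (Real.exp (-N x) * (N x + 1) ^ k) := by ring
  have hint : Integrable (fun x => ρ x * M x) μ :=
    Integrable.mono' (hbase.const_mul (C₁ * D)) ((hρm.mul hMm).aestronglyMeasurable)
      (ae_of_all _ fun x => by rw [Real.norm_eq_abs, abs_of_nonneg (mul_nonneg (hρ0 x) (hM0 x))]; exact hpt x)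
  have hnum : ∫ x, ρ x * M x ∂μ ≤ C₁ * D * B := by
    calc ∫ x, ρ x * M x ∂μ ≤ ∫ x, C₁ * D * (Real.exp (-N x) * (N x + 1) ^ k) ∂μ := integral_mono hint (hbase.const_mul _) hpt
      _ = C₁ * D * ∫ x, Real.exp (-N x) * (N x + 1) ^ k ∂μ := integral_const_mul _ _
      _ ≤ C₁ * D * B := mul_le_mul_of_nonneg_left (integral_exp_neg_mul_pow_le_of_volume_growth μ hNm hN0 hV k) (by positivity)
  -- denominator from the floor set (intersect with a measurable superset: use `toMeasurable`)
  have hρint : Integrable ρ μ :=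
    Integrable.mono' (integrable_const C₁) hρm.aestronglyMeasurable
      (ae_of_all _ fun x => by
        rw [Real.norm_eq_abs, abs_of_nonneg (hρ0 x)]
        calc ρ x ≤ C₁ * Real.exp (-N x) := hρup x
          _ ≤ C₁ * 1 := mul_le_mul_of_nonneg_left (Real.exp_le_one_iff.mpr (by linarith [hN0 x])) hC₁
          _ = C₁ := mul_one _)
  have hAρ : MeasurableSet {x | c₁ ≤ ρ x} := hρm measurableSet_Ici
  have hAsub : A ⊆ {x | c₁ ≤ ρ x} := fun x hx => hρA x hx
  have hden : c₁ * v ≤ ∫ x, ρ x ∂μ := by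
    have h1 : c₁ * μ.real {x | c₁ ≤ ρ x} ≤ ∫ x, ρ x ∂μ := by
      have hpt' : ∀ x, Set.indicator {x | c₁ ≤ ρ x} (fun _ => c₁) x ≤ ρ x := fun x => by
        by_cases hx : x ∈ {x | c₁ ≤ ρ x}
        · rw [Set.indicator_of_mem hx]; exact hx
        · rw [Set.indicator_of_notMem hx]; exact hρ0 x
      have h := integral_mono ((integrable_const c₁).indicator hAρ) hρint hpt'
      rw [integral_indicator_const _ hAρ, smul_eq_mul, mul_comm] at h
      exact h
    have h2 : μ.real A ≤ μ.real {x | c₁ ≤ ρ x} := measureReal_mono hAsub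
    nlinarith [hc₁]
  have hden0 : 0 < c₁ * v := by positivity
  -- combine
  have e : 5 * Real.exp 1 * 2 ^ k * 4 ^ m * k.factorial * m.factorial * C₁ * D * V / (c₁ * v) = C₁ * D * B / (c₁ * v) := by rw [hB]; ring
  rw [e]
  calc ∫ x, ρ x * M x ∂μ ≤ C₁ * D * B := hnum
    _ = C₁ * D * B / (c₁ * v) * (c₁ * v) := by field_simp
    _ ≤ C₁ * D * B / (c₁ * v) * ∫ x, ρ x ∂μ := mul_le_mul_of_nonneg_left hden (by positivity)

end Summit.QuantumFields.YangMills.Theorems.FemtoTransferGap.RateTube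

end
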